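import Literature.Computability.Complexity.RothvossMeasures
import HarnessLib

/-!
# Part I — Re-choosing the core block among the small blocks (set-up for Lemma 14 of Rothvoss 2017)

Continuation of the `Rothvoss*` files. In the proof of Lemma 14 of T. Rothvoss, *The matching
polytope has exponential extension complexity*, J. ACM 64 (2017) 41, a compatible partition is
generated in two phases: first the `m+1` small blocks `Ã₁, …, Ã_{m+1}` (the future `A₁, …, A_m` and
`C ∖ V(H)`), then the index `i` of the block that becomes `C ∖ V(H)`. In the encoding by bijections
`τ : TV k m ≃ Fin n` the `m+1` small blocks of `τ` are `τ(cr)` and `τ(Aⱼ)`, indexed by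
`Option (Fin m)` (`sblock`), and re-choosing the core block is PRE-COMPOSITION with the template
permutation `smallSwap j θ` exchanging `cr` and `Aⱼ` along `θ : Fin (k-3) ≃ Fin (k-3)` (for
`j = none`: permuting `cr` by `θ`).

PROVED here:
* `smallSwap j θ` fixes `ch`, `dh`, `dr`, every `Bᵢ`, and relabels blocks by the transposition
  `A j ↔ CR` (`lab_smallSwap`); hence conjugation by it preserves the `Q₃`-template matchings
  (`conj_mem_mats₀_of_relabel`, `pM_smallSwap`: `p^ex_{M,T}(H)` is unchanged) and it fixes every
  `Q₃`-template cut avoiding `Aⱼ` (`map_cut₀_smallSwap`);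
* cuts as `0/1`-vectors on the small blocks: `cutOf y = ch ∪ ⋃_{y o} sblock o`,
  `cut₀ I = cutOf (ind₀ I)`, `cutk₀ I = cutOf (ind₁ I)`, and
  `(cutOf y).map (smallSwap j θ) = cutOf (y ∘ swap none j)` (`map_cutOf_smallSwap`);
* the paper's identities `p^ex_{U,T_i}(H) = Pr_{y ∼ Z}[y ∈ Y | y_i = 0]`,
  `p^ex_{U,T_i}(C) = Pr_{y ∼ Z}[y ∈ Y | y_i = 1]` (`pU_smallSwap`, `pUk_smallSwap`), with
  `Y_τ = {y : |y| = (m+1)/2, τ(cutOf y) ∈ 𝓤}` (`Ycut`) and both denominators `= binom(m, (m+1)/2)`.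

## References

* T. Rothvoss, *The matching polytope has exponential extension complexity*, J. ACM 64(6) (2017)
  41:1–41:19, proof of Lemma 14 [Rothvoss2017].
-/

namespace Literature.Computability.Complexity

open Finset
open Literature.Probability.LatticeModels

namespace Rothvoss

open scoped Classical

variable {k m : ℕ}

/-! ### Small blocks and cuts as `0/1`-vectors -/

/-- The `m+1` small blocks: `none ↦ cr` (`C ∖ V(H)`), `some j ↦ Aⱼ`. [cite: Rothvoss2017, Lem. 14] -/
def sblock : Option (Fin m) → Finset (TV k m)
  | none => crSet
  | some j => aSet j

/-- The cut `ch ∪ ⋃_{y o = true} sblock o` encoded by `y : Option (Fin m) → Bool` (the paper's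
`f(y) = (C ∩ V(H)) ∪ ⋃_{yᵢ = 1} Ãᵢ`). [cite: Rothvoss2017, Lem. 14] -/
def cutOf (y : Option (Fin m) → Bool) : Finset (TV k m) :=
  chSet ∪ (univ.filter fun o => y o = true).biUnion sblock

/-- Membership in `cutOf y`, by cases on the vertex. [folklore] -/
theorem mem_cutOf_iff (y : Option (Fin m) → Bool) (v : TV k m) :
    v ∈ cutOf y ↔ (match v with
      | .ch _ => True
      | .cr _ => y none = true
      | .a i _ => y (some i) = true
      | _ => False) := by
  simp only [cutOf, mem_union, mem_biUnion, mem_filter, mem_univ, true_and]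
  cases v with
  | ch j =>
    simp only [iff_true]
    exact Or.inl (by simp [chSet])
  | cr x =>
    constructor
    · rintro (h | ⟨o, ho, hv⟩)
      · simp [chSet] at h
      · cases o with
        | none => exact ho
        | some i => simp [sblock, aSet] at hv
    · intro h
      exact Or.inr ⟨none, h, by simp [sblock, crSet]⟩
  | a i x =>
    constructor
    · rintro (h | ⟨o, ho, hv⟩)
      · simp [chSet] at h
      · cases o with
        | none => simp [sblock, crSet] at hv
        | some i' =>
          simp only [sblock, aSet, mem_map, mem_univ, Function.Embedding.coeFn_mk, true_and] at hv
          obtain ⟨x', hx'⟩ := hv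
          cases hx'
          exact ho
    · intro h
      exact Or.inr ⟨some i, h, by simp [sblock, aSet]⟩
  | dh j =>
    simp only [iff_false, not_or, not_exists, not_and]
    refine ⟨by simp [chSet], fun o _ => ?_⟩
    cases o <;> simp [sblock, crSet, aSet]
  | dr x =>
    simp only [iff_false, not_or, not_exists, not_and]
    refine ⟨by simp [chSet], fun o _ => ?_⟩
    cases o <;> simp [sblock, crSet, aSet]
  | b i x =>
    simp only [iff_false, not_or, not_exists, not_and]
    refine ⟨by simp [chSet], fun o _ => ?_⟩
    cases o <;> simp [sblock, crSet, aSet]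

/-- The indicator of a `Q₃`-template cut: `none ↦ 0`, `some i ↦ [i ∈ I]`. [cite: Rothvoss2017, Lem. 14] -/
def ind₀ (I : Finset (Fin m)) : Option (Fin m) → Bool := fun o => o.elim false fun i => decide (i ∈ I)

/-- The indicator of a `Q_k`-template cut: `none ↦ 1`, `some i ↦ [i ∈ I]`. [cite: Rothvoss2017, Lem. 14] -/
def ind₁ (I : Finset (Fin m)) : Option (Fin m) → Bool := fun o => o.elim true fun i => decide (i ∈ I)

/-- `cut₀ I = cutOf (ind₀ I)`. [cite: Rothvoss2017, Lem. 14] -/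
theorem cut₀_eq_cutOf (I : Finset (Fin m)) : (cut₀ I : Finset (TV k m)) = cutOf (ind₀ I) := by
  ext v
  rw [mem_cut₀, mem_cutOf_iff]
  cases v <;> simp [cutMem, ind₀]

/-- `cutk₀ I = cutOf (ind₁ I)`. [cite: Rothvoss2017, Lem. 14] -/
theorem cutk₀_eq_cutOf (I : Finset (Fin m)) : (cutk₀ I : Finset (TV k m)) = cutOf (ind₁ I) := by
  ext v
  rw [mem_cutk₀, mem_cutOf_iff]
  cases v <;> simp [cutkMem, ind₁]

/-- `cutOf` is injective when the small blocks are non-empty (`k > 3`). [folklore] -/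
theorem cutOf_injective (hk : 3 < k) :
    Function.Injective (cutOf : (Option (Fin m) → Bool) → Finset (TV k m)) := by
  intro y y' h
  have h0 : 0 < k - 3 := by omega
  funext o
  cases o with
  | none =>
    have h1 := mem_cutOf_iff y (TV.cr ⟨0, h0⟩ : TV k m)
    have h2 := mem_cutOf_iff y' (TV.cr ⟨0, h0⟩ : TV k m)
    rw [h] at h1
    simp only at h1 h2
    exact Bool.eq_iff_iff.2 (h1.symm.trans h2)
  | some i =>
    have h1 := mem_cutOf_iff y (TV.a i ⟨0, h0⟩ : TV k m)
    have h2 := mem_cutOf_iff y' (TV.a i ⟨0, h0⟩ : TV k m)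
    rw [h] at h1
    simp only at h1 h2
    exact Bool.eq_iff_iff.2 (h1.symm.trans h2)

/-- `ind₀` is injective. [folklore] -/
theorem ind₀_injective : Function.Injective (ind₀ : Finset (Fin m) → Option (Fin m) → Bool) := by
  intro I I' h
  ext i
  have := congrFun h (some i)
  simpa [ind₀] using this

/-- `ind₁` is injective. [folklore] -/
theorem ind₁_injective : Function.Injective (ind₁ : Finset (Fin m) → Option (Fin m) → Bool) := by
  intro I I' h
  ext i
  have := congrFun h (some i)
  simpa [ind₁] using this

/-- `cut₀` is injective (`k > 3`). [folklore] -/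
theorem cut₀_injective (hk : 3 < k) : Function.Injective (cut₀ : Finset (Fin m) → Finset (TV k m)) :=
  fun I I' h => ind₀_injective (cutOf_injective hk (by rw [← cut₀_eq_cutOf, ← cut₀_eq_cutOf, h]))

/-- `cutk₀` is injective (`k > 3`). [folklore] -/
theorem cutk₀_injective (hk : 3 < k) : Function.Injective (cutk₀ : Finset (Fin m) → Finset (TV k m)) :=
  fun I I' h => ind₁_injective (cutOf_injective hk (by rw [← cutk₀_eq_cutOf, ← cutk₀_eq_cutOf, h]))

/-- `|cuts₀| = binom(m, (m+1)/2)`. [cite: Rothvoss2017, §3.2] -/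
theorem card_cuts₀ (hk : 3 < k) : (cuts₀ k m).card = m.choose ((m + 1) / 2) := by
  rw [cuts₀, card_image_of_injective _ (cut₀_injective hk), card_powersetCard, card_univ,
    Fintype.card_fin]

/-- `|cutsk₀| = binom(m, (m+1)/2)` for odd `m` (`= binom(m, (m-1)/2)`). [cite: Rothvoss2017, §3.2] -/
theorem card_cutsk₀ (hk : 3 < k) (hm : Odd m) : (cutsk₀ k m).card = m.choose ((m + 1) / 2) := by
  rw [cutsk₀, card_image_of_injective _ (cutk₀_injective hk), card_powersetCard, card_univ,
    Fintype.card_fin]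
  obtain ⟨j, rfl⟩ := hm
  have e1 : (2 * j + 1 - 1) / 2 = j := by omega
  have e2 : (2 * j + 1 + 1) / 2 = j + 1 := by omega
  rw [e1, e2, Nat.choose_symm_half]

/-! ### The template permutations `smallSwap j θ` -/

/-- The parameter of the inverse swap: `θ⁻¹` for `j = none`, `θ` otherwise. [folklore] -/
def invParam (j : Option (Fin m)) (θ : Equiv.Perm (Fin (k - 3))) : Equiv.Perm (Fin (k - 3)) :=
  j.elim θ⁻¹ fun _ => θ

/-- The underlying map of `smallSwap j θ`: exchange `cr` and `Aⱼ` along `θ` (`j = some _`), or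
permute `cr` by `θ` (`j = none`); identity elsewhere. [cite: Rothvoss2017, Lem. 14] -/
def smallSwapFun (j : Option (Fin m)) (θ : Equiv.Perm (Fin (k - 3))) : TV k m → TV k m
  | .cr x => j.elim (TV.cr (θ x)) fun j => TV.a j (θ x)
  | .a i y => j.elim (TV.a i y) fun j => if i = j then TV.cr (θ.symm y) else TV.a i y
  | v => v

/-- `smallSwapFun j (invParam j θ)` inverts `smallSwapFun j θ`. [folklore] -/
theorem smallSwapFun_inv (j : Option (Fin m)) (θ : Equiv.Perm (Fin (k - 3))) (v : TV k m) :
    smallSwapFun j (invParam j θ) (smallSwapFun j θ v) = v := by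
  cases j with
  | none => cases v <;> simp [smallSwapFun, invParam]
  | some j =>
    cases v with
    | a i y =>
      by_cases h : i = j
      · subst h
        simp [smallSwapFun, invParam]
      · simp [smallSwapFun, invParam, h]
    | _ => simp [smallSwapFun, invParam]

/-- `invParam` is an involution on parameters. [folklore] -/
theorem invParam_invParam (j : Option (Fin m)) (θ : Equiv.Perm (Fin (k - 3))) :
    invParam j (invParam j θ) = θ := by
  cases j <;> simp [invParam]

/-- **`smallSwap j θ`** as a permutation of the template. [cite: Rothvoss2017, Lem. 14] -/
def smallSwap (j : Option (Fin m)) (θ : Equiv.Perm (Fin (k - 3))) : TV k m ≃ TV k m where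
  toFun := smallSwapFun j θ
  invFun := smallSwapFun j (invParam j θ)
  left_inv v := smallSwapFun_inv j θ v
  right_inv v := by
    have h := smallSwapFun_inv j (invParam j θ) v
    rwa [invParam_invParam] at h

/-- `smallSwap` acts by `smallSwapFun`. [folklore] -/
@[simp] theorem smallSwap_apply (j : Option (Fin m)) (θ : Equiv.Perm (Fin (k - 3))) (v : TV k m) :
    smallSwap j θ v = smallSwapFun j θ v := rfl

/-- The inverse of `smallSwap j θ` is `smallSwap j (invParam j θ)`. [folklore] -/
theorem smallSwap_symm (j : Option (Fin m)) (θ : Equiv.Perm (Fin (k - 3))) :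
    (smallSwap j θ : TV k m ≃ TV k m).symm = smallSwap j (invParam j θ) := by
  ext v
  rfl

/-- `smallSwap` fixes `ch`. [folklore] -/
@[simp] theorem smallSwapFun_ch (j : Option (Fin m)) (θ : Equiv.Perm (Fin (k - 3))) (i : Fin 3) :
    smallSwapFun (k := k) j θ (.ch i) = .ch i := rfl

/-- `smallSwap` fixes `dh`. [folklore] -/
@[simp] theorem smallSwapFun_dh (j : Option (Fin m)) (θ : Equiv.Perm (Fin (k - 3))) (i : Fin 3) :
    smallSwapFun (k := k) j θ (.dh i) = .dh i := rfl

/-- `smallSwap` fixes `dr`. [folklore] -/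
@[simp] theorem smallSwapFun_dr (j : Option (Fin m)) (θ : Equiv.Perm (Fin (k - 3))) (x : Fin (k - 3)) :
    smallSwapFun (m := m) j θ (.dr x) = .dr x := rfl

/-- `smallSwap` fixes every `Bᵢ`. [folklore] -/
@[simp] theorem smallSwapFun_b (j : Option (Fin m)) (θ : Equiv.Perm (Fin (k - 3))) (i : Fin m)
    (x : Fin (2 * (k - 3))) : smallSwapFun j θ (.b i x) = .b i x := rfl

/-- The block label of `some j ↦ A j`, `none ↦ CR`. [folklore] -/
def labOpt : Option (Fin m) → Lab m
  | none => .CR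
  | some j => .A j

/-- **`smallSwap j θ` relabels blocks by the transposition `A j ↔ CR`.** [cite: Rothvoss2017, Lem. 14] -/
theorem lab_smallSwap (j : Option (Fin m)) (θ : Equiv.Perm (Fin (k - 3))) (v : TV k m) :
    lab (smallSwapFun j θ v) = Equiv.swap (labOpt j) Lab.CR (lab v) := by
  cases j with
  | none => cases v <;> simp [smallSwapFun, lab, labOpt]
  | some j =>
    cases v with
    | a i y =>
      by_cases h : i = j
      · subst h
        simp [smallSwapFun, lab, labOpt]
      · simp only [smallSwapFun, Option.elim, if_neg h, lab, labOpt]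
        rw [Equiv.swap_apply_of_ne_of_ne (by simp [h]) (by simp)]
    | cr x => simp [smallSwapFun, lab, labOpt]
    | ch i => simp [smallSwapFun, lab, labOpt, Equiv.swap_apply_of_ne_of_ne]
    | dh i => simp [smallSwapFun, lab, labOpt, Equiv.swap_apply_of_ne_of_ne]
    | dr x => simp [smallSwapFun, lab, labOpt, Equiv.swap_apply_of_ne_of_ne]
    | b i x => simp [smallSwapFun, lab, labOpt, Equiv.swap_apply_of_ne_of_ne]

/-! ### Conjugation by block relabellings preserves `mats₀` -/

/-- **Block relabellings preserve the `Q₃`-template matchings.** If a template permutation `γ` fixes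
`ch` and `dh` and acts on block labels through a bijection `β` of labels, then `γ f γ⁻¹ ∈ mats₀` for
every `f ∈ mats₀`. [cite: Rothvoss2017, §3.2] -/
theorem conj_mem_mats₀_of_relabel (γ : TV k m ≃ TV k m) (β : Lab m ≃ Lab m)
    (hγ : ∀ w, lab (γ w) = β (lab w)) (hch : ∀ j, γ (.ch j) = .ch j) (hdh : ∀ j, γ (.dh j) = .dh j)
    {f : TV k m → TV k m} (hf : f ∈ mats₀ k m) : conj γ f ∈ mats₀ k m := by
  obtain ⟨hp, hH, hl⟩ := mem_mats₀.1 hf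
  have hβCH : β Lab.CH = Lab.CH := by
    have := hγ (.ch 0)
    rw [hch] at this
    simpa [lab] using this.symm
  have hβDH : β Lab.DH = Lab.DH := by
    have := hγ (.dh 0)
    rw [hdh] at this
    simpa [lab] using this.symm
  have hγ' : ∀ w, lab (γ.symm w) = β.symm (lab w) := fun w => by
    have := hγ (γ.symm w)
    rw [Equiv.apply_symm_apply] at this
    rw [this, Equiv.symm_apply_apply]
  refine mem_mats₀.2 ⟨conj_spec γ hp, fun j => ?_, fun v h1 h2 => ?_⟩
  · have : γ.symm (.ch j) = .ch j := by rw [Equiv.symm_apply_eq]; exact (hch j).symm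
    simp only [conj, this, hH, hdh]
  · simp only [conj]
    have hw1 : lab (γ.symm v) ≠ Lab.CH := by
      rw [hγ']
      intro h
      exact h1 (by rw [← hβCH, ← h, Equiv.apply_symm_apply])
    have hw2 : lab (γ.symm v) ≠ Lab.DH := by
      rw [hγ']
      intro h
      exact h2 (by rw [← hβDH, ← h, Equiv.apply_symm_apply])
    rw [hγ, hl _ hw1 hw2, hγ', Equiv.apply_symm_apply]

/-- Conjugation by `smallSwap j θ` preserves `mats₀`. [cite: Rothvoss2017, Lem. 14] -/
theorem conj_smallSwap_mem_mats₀ (j : Option (Fin m)) (θ : Equiv.Perm (Fin (k - 3)))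
    {f : TV k m → TV k m} (hf : f ∈ mats₀ k m) : conj (smallSwap j θ) f ∈ mats₀ k m :=
  conj_mem_mats₀_of_relabel (smallSwap j θ) (Equiv.swap (labOpt j) Lab.CR) (lab_smallSwap j θ)
    (fun _ => rfl) (fun _ => rfl) hf

/-- **`p^ex_{M,T}(H)` is unchanged by re-choosing the core block** (the same family of blocks is
preserved). [cite: Rothvoss2017, Lem. 14] -/
theorem pM_smallSwap (𝓜 : Finset ((⊤ : SimpleGraph (Fin (rvN k m))).Subgraph)) (j : Option (Fin m))
    (θ : Equiv.Perm (Fin (k - 3))) (τ : Bij k m) :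
    pM k m 𝓜 ((smallSwap j θ).trans τ) = pM k m 𝓜 τ := by
  unfold pM
  congr 2
  refine card_bij' (fun f _ => conj (smallSwap j θ) f) (fun f _ => conj (smallSwap j θ).symm f)
    (fun f hf => ?_) (fun f hf => ?_) (fun f _ => conj_symm_conj _ _) (fun f _ => conj_conj_symm _ _)
  · obtain ⟨hf, hM⟩ := mem_filter.1 hf
    refine mem_filter.2 ⟨conj_smallSwap_mem_mats₀ j θ hf, ?_⟩
    rwa [← toSub_trans _ _ (mem_mats₀.1 hf).1]
  · obtain ⟨hf, hM⟩ := mem_filter.1 hf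
    have hmem : conj (smallSwap j θ).symm f ∈ mats₀ k m := by
      rw [smallSwap_symm]
      exact conj_smallSwap_mem_mats₀ j _ hf
    refine mem_filter.2 ⟨hmem, ?_⟩
    rw [toSub_trans _ _ (mem_mats₀.1 hmem).1, conj_conj_symm]
    exact hM

/-- **`smallSwap j θ` fixes the `Q₃`-template cuts avoiding `Aⱼ`** (point-wise).
[cite: Rothvoss2017, Lem. 14] -/
theorem map_cut₀_smallSwap {j : Option (Fin m)} {I : Finset (Fin m)} (hj : ∀ i, j = some i → i ∉ I)
    (θ : Equiv.Perm (Fin (k - 3))) :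
    (cut₀ I : Finset (TV k m)).map (smallSwap j θ).toEmbedding = cut₀ I := by
  refine map_eq_of_subset fun v hv => ?_
  rw [mem_map] at hv
  obtain ⟨w, hw, rfl⟩ := hv
  rw [Equiv.coe_toEmbedding, smallSwap_apply]
  rw [mem_cut₀] at hw
  cases w with
  | ch i => simpa using hw
  | a i y =>
    have hi : i ∈ I := by simpa [cutMem] using hw
    cases j with
    | none => simpa [smallSwapFun] using hw
    | some j =>
      have hij : i ≠ j := fun h => hj j rfl (h ▸ hi)
      simpa [smallSwapFun, hij] using hw
  | _ => simp [cutMem] at hw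

/-- The image of a small block under `smallSwap j θ`: blocks `none` and `j` are exchanged.
[cite: Rothvoss2017, Lem. 14] -/
theorem mem_map_sblock_smallSwap (j : Option (Fin m)) (θ : Equiv.Perm (Fin (k - 3)))
    (o : Option (Fin m)) (v : TV k m) :
    v ∈ (sblock o).map (smallSwap j θ).toEmbedding ↔ v ∈ sblock (Equiv.swap none j o) := by
  rw [mem_map]
  simp only [Equiv.coe_toEmbedding, smallSwap_apply]
  cases j with
  | none =>
    rw [Equiv.swap_self, Equiv.refl_apply]
    cases o with
    | none =>
      simp only [sblock, crSet, mem_map, mem_univ, Function.Embedding.coeFn_mk, true_and]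
      constructor
      · rintro ⟨w, ⟨x, rfl⟩, rfl⟩
        exact ⟨θ x, rfl⟩
      · rintro ⟨x, rfl⟩
        exact ⟨.cr (θ.symm x), ⟨_, rfl⟩, by simp [smallSwapFun]⟩
    | some i =>
      simp only [sblock, aSet, mem_map, mem_univ, Function.Embedding.coeFn_mk, true_and]
      constructor
      · rintro ⟨w, ⟨x, rfl⟩, rfl⟩
        exact ⟨x, rfl⟩
      · rintro ⟨x, rfl⟩
        exact ⟨.a i x, ⟨_, rfl⟩, rfl⟩
  | some j =>
    cases o with
    | none =>
      rw [Equiv.swap_apply_left]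
      simp only [sblock, crSet, aSet, mem_map, mem_univ, Function.Embedding.coeFn_mk, true_and]
      constructor
      · rintro ⟨w, ⟨x, rfl⟩, rfl⟩
        exact ⟨θ x, rfl⟩
      · rintro ⟨x, rfl⟩
        exact ⟨.cr (θ.symm x), ⟨_, rfl⟩, by simp [smallSwapFun]⟩
    | some i =>
      by_cases hij : i = j
      · subst hij
        rw [Equiv.swap_apply_right]
        simp only [sblock, crSet, aSet, mem_map, mem_univ, Function.Embedding.coeFn_mk, true_and]
        constructor
        · rintro ⟨w, ⟨x, rfl⟩, rfl⟩
          exact ⟨θ.symm x, by simp [smallSwapFun]⟩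
        · rintro ⟨x, rfl⟩
          exact ⟨.a i (θ x), ⟨_, rfl⟩, by simp [smallSwapFun]⟩
      · rw [Equiv.swap_apply_of_ne_of_ne (by simp) (by simp [hij])]
        simp only [sblock, aSet, mem_map, mem_univ, Function.Embedding.coeFn_mk, true_and]
        constructor
        · rintro ⟨w, ⟨x, rfl⟩, rfl⟩
          exact ⟨x, by simp [smallSwapFun, hij]⟩
        · rintro ⟨x, rfl⟩
          exact ⟨.a i x, ⟨_, rfl⟩, by simp [smallSwapFun, hij]⟩

/-- **Cuts transform by swapping coordinates**: `smallSwap j θ (cutOf y) = cutOf (y ∘ swap none j)`.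
[cite: Rothvoss2017, Lem. 14] -/
theorem map_cutOf_smallSwap (j : Option (Fin m)) (θ : Equiv.Perm (Fin (k - 3)))
    (y : Option (Fin m) → Bool) :
    (cutOf y : Finset (TV k m)).map (smallSwap j θ).toEmbedding = cutOf (y ∘ Equiv.swap none j) := by
  have hch : (chSet : Finset (TV k m)).map (smallSwap j θ).toEmbedding = chSet := by
    refine map_eq_of_subset fun w hw => ?_
    rw [mem_map] at hw
    obtain ⟨u, hu, rfl⟩ := hw
    simp only [chSet, mem_map, mem_univ, Function.Embedding.coeFn_mk, true_and] at hu
    obtain ⟨i, rfl⟩ := hu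
    simp [chSet]
  ext v
  rw [cutOf, cutOf, map_union, hch, mem_union, mem_union]
  apply or_congr_right
  rw [mem_biUnion]
  constructor
  · intro hv
    rw [mem_map] at hv
    obtain ⟨w, hw, rfl⟩ := hv
    rw [mem_biUnion] at hw
    obtain ⟨o, ho, hwo⟩ := hw
    refine ⟨Equiv.swap none j o, ?_, ?_⟩
    · rw [mem_filter] at ho ⊢
      refine ⟨mem_univ _, ?_⟩
      rw [Function.comp_apply, Equiv.swap_apply_self]
      exact ho.2
    · exact (mem_map_sblock_smallSwap j θ o _).1 (mem_map_of_mem _ hwo)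
  · rintro ⟨o, ho, hv⟩
    rw [mem_filter, Function.comp_apply] at ho
    have hv' : v ∈ (sblock (Equiv.swap none j o)).map (smallSwap j θ).toEmbedding := by
      rw [mem_map_sblock_smallSwap, Equiv.swap_apply_self]
      exact hv
    rw [mem_map] at hv' ⊢
    obtain ⟨w, hw, hwv⟩ := hv'
    exact ⟨w, mem_biUnion.2 ⟨_, mem_filter.2 ⟨mem_univ _, ho.2⟩, hw⟩, hwv⟩

/-! ### `p^ex_U` after a swap, as conditional probabilities on `0/1`-vectors -/

/-- The number of `1`s of a `0/1`-vector on the small blocks. [folklore] -/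
def wt (y : Option (Fin m) → Bool) : ℕ := ((univ : Finset (Option (Fin m))).filter fun o => y o = true).card

/-- `wt (ind₀ I) = |I|`. [folklore] -/
theorem wt_ind₀ (I : Finset (Fin m)) : wt (ind₀ I) = I.card := by
  rw [wt]
  have : ((univ : Finset (Option (Fin m))).filter fun o => ind₀ I o = true) =
      I.map ⟨some, Option.some_injective _⟩ := by
    ext o
    cases o <;> simp [ind₀]
  rw [this, card_map]

/-- `wt (ind₁ I) = |I| + 1`. [folklore] -/
theorem wt_ind₁ (I : Finset (Fin m)) : wt (ind₁ I) = I.card + 1 := by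
  rw [wt]
  have : ((univ : Finset (Option (Fin m))).filter fun o => ind₁ I o = true) =
      insert none (I.map ⟨some, Option.some_injective _⟩) := by
    ext o
    cases o <;> simp [ind₁]
  rw [this, card_insert_of_notMem (by simp), card_map]

/-- `wt` is invariant under permuting coordinates. [folklore] -/
theorem wt_comp_equiv (y : Option (Fin m) → Bool) (e : Option (Fin m) ≃ Option (Fin m)) :
    wt (y ∘ e) = wt y := by
  rw [wt, wt]
  have : ((univ : Finset (Option (Fin m))).filter fun o => (y ∘ e) o = true) =
      ((univ : Finset (Option (Fin m))).filter fun o => y o = true).map e.symm.toEmbedding := by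
    ext o
    simp [mem_map_equiv]
  rw [this, card_map]

/-- Reconstructing `y` with `y j = 0` from its values off `j`, read through `swap none j`. [folklore] -/
theorem ind₀_comp_swap_eq {y : Option (Fin m) → Bool} {j : Option (Fin m)} (hyj : y j = false) :
    ind₀ ((univ : Finset (Fin m)).filter fun i => y (Equiv.swap none j (some i)) = true) ∘
      Equiv.swap none j = y := by
  funext o
  simp only [Function.comp_apply]
  rcases ho : Equiv.swap none j o with _ | i
  · have hoj : o = j := by simpa using congrArg (Equiv.swap none j) ho
    subst hoj
    simp [ind₀, hyj]
  · have hoi : o = Equiv.swap none j (some i) := by simpa using congrArg (Equiv.swap none j) ho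
    subst hoi
    simp [ind₀]

/-- Reconstructing `y` with `y j = 1` from its values off `j`, read through `swap none j`. [folklore] -/
theorem ind₁_comp_swap_eq {y : Option (Fin m) → Bool} {j : Option (Fin m)} (hyj : y j = true) :
    ind₁ ((univ : Finset (Fin m)).filter fun i => y (Equiv.swap none j (some i)) = true) ∘
      Equiv.swap none j = y := by
  funext o
  simp only [Function.comp_apply]
  rcases ho : Equiv.swap none j o with _ | i
  · have hoj : o = j := by simpa using congrArg (Equiv.swap none j) ho
    subst hoj
    simp [ind₁, hyj]
  · have hoi : o = Equiv.swap none j (some i) := by simpa using congrArg (Equiv.swap none j) ho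
    subst hoi
    simp [ind₁]

/-- The weight of a vector vanishing at `j`, counted off `j`. [folklore] -/
theorem card_filter_off_eq_wt {y : Option (Fin m) → Bool} {j : Option (Fin m)} (hyj : y j = false) :
    ((univ : Finset (Fin m)).filter fun i => y (Equiv.swap none j (some i)) = true).card = wt y := by
  rw [← wt_comp_equiv y (Equiv.swap none j), wt]
  have : ((univ : Finset (Option (Fin m))).filter fun o => (y ∘ Equiv.swap none j) o = true) =
      ((univ : Finset (Fin m)).filter fun i => y (Equiv.swap none j (some i)) = true).map
        ⟨some, Option.some_injective _⟩ := by
    ext o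
    cases o with
    | none => simp [hyj]
    | some i => simp
  rw [this, card_map]

/-- The weight of a vector equal to `1` at `j`, counted off `j`. [folklore] -/
theorem card_filter_off_eq_wt_pred {y : Option (Fin m) → Bool} {j : Option (Fin m)} (hyj : y j = true) :
    ((univ : Finset (Fin m)).filter fun i => y (Equiv.swap none j (some i)) = true).card + 1 = wt y := by
  rw [← wt_comp_equiv y (Equiv.swap none j), wt]
  have : ((univ : Finset (Option (Fin m))).filter fun o => (y ∘ Equiv.swap none j) o = true) =
      insert none (((univ : Finset (Fin m)).filter fun i => y (Equiv.swap none j (some i)) = true).map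
        ⟨some, Option.some_injective _⟩) := by
    ext o
    cases o with
    | none => simp [hyj]
    | some i => simp
  rw [this, card_insert_of_notMem (by simp), card_map]

variable (k) in
/-- **`Y_τ`**: the `0/1`-vectors of weight `(m+1)/2` whose cut lands in `𝓤` under `τ` (the paper's
`Y = {y : f(y) ∈ 𝓤}` intersected with `Z = {‖y‖₁ = (m+1)/2}`). [cite: Rothvoss2017, Lem. 14] -/
def Ycut (𝓤 : Finset (Finset (Fin (rvN k m)))) (τ : Bij k m) : Finset (Option (Fin m) → Bool) :=
  univ.filter fun y => wt y = (m + 1) / 2 ∧ (cutOf y).map τ.toEmbedding ∈ 𝓤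

/-- Membership in `Y_τ`. [folklore] -/
theorem mem_Ycut {𝓤 : Finset (Finset (Fin (rvN k m)))} {τ : Bij k m} {y : Option (Fin m) → Bool} :
    y ∈ Ycut k 𝓤 τ ↔ wt y = (m + 1) / 2 ∧ (cutOf y).map τ.toEmbedding ∈ 𝓤 := by
  simp [Ycut]

/-- **`p^ex_{U,T_j}(H)` as a conditional probability**: after re-choosing block `j` as the core block,
`pU = #{y ∈ Y_τ : y j = 0} / binom(m, (m+1)/2)`. [cite: Rothvoss2017, Lem. 14] -/
theorem pU_smallSwap (hk : 3 < k) (𝓤 : Finset (Finset (Fin (rvN k m)))) (j : Option (Fin m))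
    (θ : Equiv.Perm (Fin (k - 3))) (τ : Bij k m) :
    pU k m 𝓤 ((smallSwap j θ).trans τ) =
      (((Ycut k 𝓤 τ).filter fun y => y j = false).card : ℝ) / m.choose ((m + 1) / 2) := by
  unfold pU
  rw [card_cuts₀ hk]
  congr 1
  norm_cast
  rw [cuts₀, filter_image, card_image_of_injective _ (cut₀_injective hk)]
  have hmapU : ∀ I : Finset (Fin m), (cut₀ I : Finset (TV k m)).map ((smallSwap j θ).trans τ).toEmbedding =
      (cutOf (ind₀ I ∘ Equiv.swap none j)).map τ.toEmbedding := fun I => by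
    rw [Equiv.trans_toEmbedding, ← map_map, cut₀_eq_cutOf, map_cutOf_smallSwap]
  refine card_bij' (fun I _ => ind₀ I ∘ Equiv.swap none j)
    (fun y _ => univ.filter fun i => y (Equiv.swap none j (some i)) = true)
    (fun I hI => ?_) (fun y hy => ?_) (fun I _ => ?_) (fun y hy => ?_)
  · obtain ⟨hI, hU⟩ := mem_filter.1 hI
    rw [mem_powersetCard] at hI
    rw [hmapU] at hU
    refine mem_filter.2 ⟨mem_Ycut.2 ⟨?_, hU⟩, ?_⟩
    · rw [wt_comp_equiv, wt_ind₀, hI.2]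
    · simp [ind₀]
  · obtain ⟨hy, hyj⟩ := mem_filter.1 hy
    obtain ⟨hwt, hU⟩ := mem_Ycut.1 hy
    refine mem_filter.2 ⟨mem_powersetCard.2 ⟨subset_univ _, ?_⟩, ?_⟩
    · rw [card_filter_off_eq_wt hyj, hwt]
    · rw [hmapU, ind₀_comp_swap_eq hyj]
      exact hU
  · ext i
    simp [ind₀]
  · obtain ⟨-, hyj⟩ := mem_filter.1 hy
    exact ind₀_comp_swap_eq hyj

/-- **`p^ex_{U,T_j}(C)` as a conditional probability**: after re-choosing block `j` as the core block,
`pUk = #{y ∈ Y_τ : y j = 1} / binom(m, (m+1)/2)` (`m` odd). [cite: Rothvoss2017, Lem. 14] -/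
theorem pUk_smallSwap (hk : 3 < k) (hm : Odd m) (𝓤 : Finset (Finset (Fin (rvN k m))))
    (j : Option (Fin m)) (θ : Equiv.Perm (Fin (k - 3))) (τ : Bij k m) :
    pUk k m 𝓤 ((smallSwap j θ).trans τ) =
      (((Ycut k 𝓤 τ).filter fun y => y j = true).card : ℝ) / m.choose ((m + 1) / 2) := by
  unfold pUk
  rw [card_cutsk₀ hk hm]
  congr 1
  norm_cast
  rw [cutsk₀, filter_image, card_image_of_injective _ (cutk₀_injective hk)]
  have hmapU : ∀ I : Finset (Fin m), (cutk₀ I : Finset (TV k m)).map ((smallSwap j θ).trans τ).toEmbedding =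
      (cutOf (ind₁ I ∘ Equiv.swap none j)).map τ.toEmbedding := fun I => by
    rw [Equiv.trans_toEmbedding, ← map_map, cutk₀_eq_cutOf, map_cutOf_smallSwap]
  have hhalf : (m - 1) / 2 + 1 = (m + 1) / 2 := by
    obtain ⟨i, rfl⟩ := hm
    omega
  refine card_bij' (fun I _ => ind₁ I ∘ Equiv.swap none j)
    (fun y _ => univ.filter fun i => y (Equiv.swap none j (some i)) = true)
    (fun I hI => ?_) (fun y hy => ?_) (fun I _ => ?_) (fun y hy => ?_)
  · obtain ⟨hI, hU⟩ := mem_filter.1 hI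
    rw [mem_powersetCard] at hI
    rw [hmapU] at hU
    refine mem_filter.2 ⟨mem_Ycut.2 ⟨?_, hU⟩, ?_⟩
    · rw [wt_comp_equiv, wt_ind₁, hI.2, hhalf]
    · simp [ind₁]
  · obtain ⟨hy, hyj⟩ := mem_filter.1 hy
    obtain ⟨hwt, hU⟩ := mem_Ycut.1 hy
    refine mem_filter.2 ⟨mem_powersetCard.2 ⟨subset_univ _, ?_⟩, ?_⟩
    · have h := card_filter_off_eq_wt_pred hyj
      rw [hwt] at h
      omega
    · rw [hmapU, ind₁_comp_swap_eq hyj]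
      exact hU
  · ext i
    simp [ind₁]
  · obtain ⟨-, hyj⟩ := mem_filter.1 hy
    exact ind₁_comp_swap_eq hyj

end Rothvoss

end Literature.Computability.Complexity

/-!
# Part II — The contribution of `U`-bad pairs (Rothvoss 2017, Lemma 14)

Continuation of the `Rothvoss*` files (T. Rothvoss, *The matching polytope has exponential
extension complexity*, J. ACM 64 (2017) 41, §3.6.1). In the encoding by bijections
`τ : TV k m ≃ Fin n`, the paper's bound `Pr_{T ∼ 𝒫(U,M)}[U-BAD] ≤ η` for every pair `(U, M)` is
replaced by the following *uniform-cover* double counting, which needs no description of the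
compatible partitions `𝒫(U, M)`:

* `sum_bad_le_of_cover` — if a weight `w ≥ 0` on encodings is invariant under precomposition with
  every swap `γ x` (`x ∈ Γ`) and, for EVERY `τ`, at most an `η`-fraction of the swapped encodings
  `γ x ∘ τ` is bad, then `∑_{τ bad} w τ ≤ η ∑_τ w τ`;
* for the `U`-part the weight is `[τ(cut₀ I) ∈ 𝓤] · p^ex_{M}(τ)` for a fixed template cut, the swaps
  are the small-block swaps `smallSwap j θ` with `Aⱼ ⊄ cut₀ I` (`swapsU`), both invariances were
  proved in Part I above, and the per-`τ` count (`card_ubad_le`) is the paper's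
  second-phase argument: a `U`-bad swapped encoding is not small, so
  `|Y_τ| ≥ 2^{-δ m} binom(m, (m+1)/2)`, and by the entropy lemma (`few_biased_coordinates`, taken here
  as the hypothesis `hL10` for `0/1`-vectors) all but `ε₁ (m+1)` block indices are `ε₁`-unbiased,
  which by Corollary 12 (`ugood_of_unbiased`) makes the swapped encoding `U`-good.

Main result: `ubad_part` —
`∑_τ U-BAD(τ) · pU τ · pM τ ≤ 2 ε₁ · ∑_τ pU τ · pM τ`, given `(1+ε₁)² ≤ 1+ε` and the density
threshold `2^{-δ₁ (m+1)} 2^{m+1} ≤ 2^{-δ m} binom(m, (m+1)/2)`.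

## References

* T. Rothvoss, *The matching polytope has exponential extension complexity*, J. ACM 64(6) (2017)
  41:1–41:19, §3.5 (Cor. 12) and §3.6.1 (Lemma 14) [Rothvoss2017].
-/

namespace Literature.Computability.Complexity

open Finset
open Literature.Probability.LatticeModels

namespace Rothvoss

open scoped Classical

variable {k m : ℕ}

/-! ### Uniform covers -/

/-- **Uniform-cover double counting** (replaces the conditioning on `𝒫(U, M)` of §3.6): if a
nonnegative weight `w` on encodings is invariant under precomposition with each swap `γ x`, `x ∈ Γ`
(`Γ ≠ ∅`), and for every encoding `τ` at most an `η`-fraction of the encodings `γ x ∘ τ` is bad, then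
the bad encodings carry at most an `η`-fraction of the total weight. [cite: Rothvoss2017, §3.6] -/
theorem sum_bad_le_of_cover {X : Type*} (Γ : Finset X) (hΓ : Γ.Nonempty) (γ : X → TV k m ≃ TV k m)
    (w : Bij k m → ℝ) (hw : ∀ τ, 0 ≤ w τ) (hinv : ∀ x ∈ Γ, ∀ τ, w ((γ x).trans τ) = w τ)
    (Bad : Bij k m → Prop) {η : ℝ}
    (hbad : ∀ τ : Bij k m,
      (((Γ.filter fun x => Bad ((γ x).trans τ)).card : ℕ) : ℝ) ≤ η * Γ.card) :
    ∑ τ, (if Bad τ then w τ else 0) ≤ η * ∑ τ, w τ := by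
  have hΓpos : (0 : ℝ) < Γ.card := by exact_mod_cast hΓ.card_pos
  have key : (Γ.card : ℝ) * ∑ τ, (if Bad τ then w τ else 0) =
      ∑ τ, w τ * ((Γ.filter fun x => Bad ((γ x).trans τ)).card : ℝ) := by
    calc (Γ.card : ℝ) * ∑ τ, (if Bad τ then w τ else 0)
        = ∑ _x ∈ Γ, ∑ τ, (if Bad τ then w τ else 0) := by rw [sum_const, nsmul_eq_mul]
      _ = ∑ x ∈ Γ, ∑ τ, (if Bad ((γ x).trans τ) then w τ else 0) := by
          refine sum_congr rfl fun x hx => ?_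
          have h := sum_resample (γ x) (fun τ => if Bad τ then w τ else 0)
          simp only [hinv x hx] at h
          exact h.symm
      _ = ∑ τ, ∑ x ∈ Γ, (if Bad ((γ x).trans τ) then w τ else 0) := sum_comm
      _ = ∑ τ, w τ * ((Γ.filter fun x => Bad ((γ x).trans τ)).card : ℝ) := by
          refine sum_congr rfl fun τ _ => ?_
          rw [natCast_card_filter, mul_sum]
          refine sum_congr rfl fun x _ => ?_
          split_ifs <;> simp
  have h2 : ∑ τ, w τ * ((Γ.filter fun x => Bad ((γ x).trans τ)).card : ℝ) ≤
      ∑ τ, w τ * (η * Γ.card) :=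
    sum_le_sum fun τ _ => mul_le_mul_of_nonneg_left (hbad τ) (hw τ)
  rw [← key, ← sum_mul] at h2
  refine le_of_mul_le_mul_left ?_ hΓpos
  calc (Γ.card : ℝ) * ∑ τ, (if Bad τ then w τ else 0) ≤ (∑ τ, w τ) * (η * Γ.card) := h2
    _ = Γ.card * (η * ∑ τ, w τ) := by ring

/-! ### Bad pairs -/

section Defs

variable (k m)
variable (𝓤 : Finset (Finset (Fin (rvN k m))))
  (𝓜 : Finset ((⊤ : SimpleGraph (Fin (rvN k m))).Subgraph)) (ε δ : ℝ)

/-- **`U`-bad** pairs `(T, H)`: neither small nor `U`-good. [cite: Rothvoss2017, §3.6] -/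
def UBad (τ : Bij k m) := ¬ Small k m 𝓤 𝓜 δ τ ∧ ¬ UGood k m 𝓤 ε τ

/-- **`M`-bad** pairs `(T, H)`: neither small nor `M`-good. [cite: Rothvoss2017, §3.6] -/
def MBad (τ : Bij k m) := ¬ Small k m 𝓤 𝓜 δ τ ∧ ¬ MGood k m 𝓜 ε τ

/-- The weight `[τ(cut₀ I) ∈ 𝓤] · p^ex_{M,T}(H)` of an encoding, for a fixed template cut `cut₀ I`
(so that `pU τ · pM τ` is the average of these weights over `I`). [cite: Rothvoss2017, §3.6] -/
noncomputable def wU (I : Finset (Fin m)) (τ : Bij k m) : ℝ :=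
  (if (cut₀ I : Finset (TV k m)).map τ.toEmbedding ∈ 𝓤 then 1 else 0) * pM k m 𝓜 τ

end Defs

/-- `BAD ⊆ U-BAD ∪ M-BAD`. [cite: Rothvoss2017, §3.6] -/
theorem ubad_or_mbad {𝓤 : Finset (Finset (Fin (rvN k m)))}
    {𝓜 : Finset ((⊤ : SimpleGraph (Fin (rvN k m))).Subgraph)} {ε δ : ℝ} {τ : Bij k m}
    (hs : ¬ Small k m 𝓤 𝓜 δ τ) (hg : ¬ Good k m 𝓤 𝓜 ε τ) :
    UBad k m 𝓤 𝓜 ε δ τ ∨ MBad k m 𝓤 𝓜 ε δ τ := by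
  unfold Good at hg
  unfold UBad MBad
  tauto

/-! ### The free small blocks and the swaps of the `U`-part -/

/-- The small blocks not inside the cut `cut₀ I` — the candidates for the core block `C ∖ V(H)`:
`none` (the current core block) and the `Aᵢ` with `i ∉ I` (the paper's index set `J`).
[cite: Rothvoss2017, Lem. 14] -/
def freeIdx (I : Finset (Fin m)) : Finset (Option (Fin m)) :=
  univ.filter fun j => ∀ i, j = some i → i ∉ I

/-- Membership in `freeIdx`. [folklore] -/
theorem mem_freeIdx {I : Finset (Fin m)} {j : Option (Fin m)} :
    j ∈ freeIdx I ↔ ∀ i, j = some i → i ∉ I := by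
  simp [freeIdx]

/-- The current core block is always free. [folklore] -/
theorem none_mem_freeIdx (I : Finset (Fin m)) : (none : Option (Fin m)) ∈ freeIdx I :=
  mem_freeIdx.2 fun i h => (Option.some_ne_none i h.symm).elim

/-- **`|J| = (m+1)/2`** for `|I| = (m+1)/2` and `m` odd. [cite: Rothvoss2017, Lem. 14] -/
theorem card_freeIdx (hm : Odd m) {I : Finset (Fin m)} (hI : I.card = (m + 1) / 2) :
    (freeIdx I).card = (m + 1) / 2 := by
  have h : freeIdx I = univ \ I.map ⟨some, Option.some_injective _⟩ := by
    ext j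
    rw [mem_freeIdx, mem_sdiff, mem_map]
    simp only [mem_univ, true_and, Function.Embedding.coeFn_mk, not_exists, not_and]
    constructor
    · intro hj i hi h
      exact hj i h.symm hi
    · intro hj i h hi
      exact hj i hi h.symm
  rw [h, card_univ_sdiff, card_map, Fintype.card_option, Fintype.card_fin, hI]
  obtain ⟨r, rfl⟩ := hm
  omega

variable (k) in
/-- The swaps of the `U`-part for the template cut `cut₀ I`: a free small block `j` and an
identification `θ` of it with the core block. [cite: Rothvoss2017, Lem. 14] -/
def swapsU (I : Finset (Fin m)) : Finset (Option (Fin m) × Equiv.Perm (Fin (k - 3))) :=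
  freeIdx I ×ˢ univ

/-- Membership in `swapsU`. [folklore] -/
theorem mem_swapsU {I : Finset (Fin m)} {p : Option (Fin m) × Equiv.Perm (Fin (k - 3))} :
    p ∈ swapsU k I ↔ p.1 ∈ freeIdx I := by
  simp [swapsU]

/-- `|swapsU I| = |J| · (k-3)!`. [folklore] -/
theorem card_swapsU (I : Finset (Fin m)) :
    (swapsU k I).card = (freeIdx I).card * (univ : Finset (Equiv.Perm (Fin (k - 3)))).card :=
  card_product _ _

/-- `swapsU I` is nonempty (it contains `(none, 1)`). [folklore] -/
theorem swapsU_nonempty (I : Finset (Fin m)) : (swapsU k I).Nonempty :=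
  ⟨(none, 1), mem_swapsU.2 (none_mem_freeIdx I)⟩

/-! ### Corollary 12: unbiased indices give `U`-good pairs -/

/-- The arithmetic of Corollary 12 of Rothvoss 2017: two-sided `ε₁`-unbiasedness of a `0/1`
coordinate (`|Y|/(2(1+ε₁)) ≤ N_b ≤ (1+ε₁)|Y|/2`, `b = 0, 1`) gives
`N₀/(1+ε) ≤ N₁ ≤ (1+ε) N₀` as soon as `(1+ε₁)² ≤ 1+ε` (stated for the conditional probabilities
`N_b / C`). [cite: Rothvoss2017, Cor. 12] -/
theorem ratio_bounds_of_unbiased {ε ε₁ Yc N₀ N₁ C : ℝ} (hε₁ : 0 ≤ ε₁)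
    (hε : (1 + ε₁) ^ 2 ≤ 1 + ε) (hC : 0 < C) (h0 : 0 ≤ N₀) (h1 : 0 ≤ N₁)
    (hl0 : Yc / ((1 + ε₁) * 2) ≤ N₀) (hu0 : N₀ ≤ (1 + ε₁) * Yc / 2)
    (hl1 : Yc / ((1 + ε₁) * 2) ≤ N₁) (hu1 : N₁ ≤ (1 + ε₁) * Yc / 2) :
    N₀ / C / (1 + ε) ≤ N₁ / C ∧ N₁ / C ≤ (1 + ε) * (N₀ / C) := by
  have h1ε₁ : (0 : ℝ) ≤ 1 + ε₁ := by linarith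
  have h2 : (0 : ℝ) < (1 + ε₁) * 2 := by positivity
  rw [div_le_iff₀ h2] at hl0 hl1
  rw [le_div_iff₀ (by norm_num : (0 : ℝ) < 2)] at hu0 hu1
  have hε0 : 0 < 1 + ε := by nlinarith
  have hC' : 0 ≤ C := hC.le
  have hN₁ : N₁ ≤ (1 + ε) * N₀ := by
    have : N₁ * 2 ≤ (1 + ε) * N₀ * 2 :=
      calc N₁ * 2 ≤ (1 + ε₁) * Yc := hu1
        _ ≤ (1 + ε₁) * (N₀ * ((1 + ε₁) * 2)) := mul_le_mul_of_nonneg_left hl0 h1ε₁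
        _ = (1 + ε₁) ^ 2 * N₀ * 2 := by ring
        _ ≤ (1 + ε) * N₀ * 2 := by gcongr
    linarith
  have hN₀ : N₀ ≤ (1 + ε) * N₁ := by
    have : N₀ * 2 ≤ (1 + ε) * N₁ * 2 :=
      calc N₀ * 2 ≤ (1 + ε₁) * Yc := hu0
        _ ≤ (1 + ε₁) * (N₁ * ((1 + ε₁) * 2)) := mul_le_mul_of_nonneg_left hl1 h1ε₁
        _ = (1 + ε₁) ^ 2 * N₁ * 2 := by ring
        _ ≤ (1 + ε) * N₁ * 2 := by gcongr
    linarith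
  constructor
  · rw [div_le_iff₀ hε0]
    calc N₀ / C ≤ (1 + ε) * N₁ / C := by gcongr
      _ = N₁ / C * (1 + ε) := by ring
  · calc N₁ / C ≤ (1 + ε) * N₀ / C := by gcongr
      _ = (1 + ε) * (N₀ / C) := by ring

/-- **Corollary 12 ⇒ `U`-goodness**: if, after re-choosing block `j` as the core block, `p^ex_U > 0`
and the coordinate `j` is `ε₁`-unbiased for `Y_τ` (with `(1+ε₁)² ≤ 1+ε`), then the new pair is
`U`-good — by `pU_smallSwap`/`pUk_smallSwap` both `p^ex_U(H)` and `p^ex_U(C)` are conditional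
probabilities `Pr_Z[Y | y_j = b]` with the same denominator. [cite: Rothvoss2017, Cor. 12 & Lem. 14] -/
theorem ugood_of_unbiased (hk : 3 < k) (hm : Odd m) {ε ε₁ : ℝ} (hε₁ : 0 ≤ ε₁)
    (hε : (1 + ε₁) ^ 2 ≤ 1 + ε) {𝓤 : Finset (Finset (Fin (rvN k m)))} {τ : Bij k m}
    {j : Option (Fin m)} (θ : Equiv.Perm (Fin (k - 3)))
    (hpos : 0 < pU k m 𝓤 ((smallSwap j θ).trans τ))
    (hunb : ∀ b : Bool, ((Ycut k 𝓤 τ).card : ℝ) / ((1 + ε₁) * 2) ≤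
        ((Ycut k 𝓤 τ).filter fun y => y j = b).card ∧
      (((Ycut k 𝓤 τ).filter fun y => y j = b).card : ℝ) ≤ (1 + ε₁) * (Ycut k 𝓤 τ).card / 2) :
    UGood k m 𝓤 ε ((smallSwap j θ).trans τ) := by
  have hC : (0 : ℝ) < m.choose ((m + 1) / 2) := by exact_mod_cast Nat.choose_pos (by omega)
  unfold UGood
  refine ⟨hpos, ?_⟩
  rw [pU_smallSwap hk, pUk_smallSwap hk hm]
  exact ratio_bounds_of_unbiased hε₁ hε hC (Nat.cast_nonneg _) (Nat.cast_nonneg _)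
    (hunb false).1 (hunb false).2 (hunb true).1 (hunb true).2

/-! ### Lemma 14: the per-encoding count -/

/-- **Lemma 14 of Rothvoss 2017 (second phase, per encoding).** Fix an encoding `τ` and a template
cut `cut₀ I`, `|I| = (m+1)/2`. Among the swaps `(j, θ) ∈ swapsU I` (re-choosing the core block among
the `(m+1)/2` free small blocks), at most a `2ε₁`-fraction yields a `U`-bad encoding: if some
swapped encoding is `U`-bad it is not small, so `|Y_τ| ≥ 2^{-δ m} binom(m, (m+1)/2) ≥ 2^{-δ₁(m+1)}
2^{m+1}`; then (entropy lemma, hypothesis `hL10`) all but `ε₁ (m+1)` indices are `ε₁`-unbiased, and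
those give `U`-good encodings (`ugood_of_unbiased`). [cite: Rothvoss2017, Lem. 14] -/
theorem card_ubad_le (hk : 3 < k) (hm : Odd m) {ε ε₁ δ δ₁ : ℝ} (hε₁ : 0 ≤ ε₁)
    (hε : (1 + ε₁) ^ 2 ≤ 1 + ε)
    (hL10 : ∀ Y : Finset (Option (Fin m) → Bool),
      (2 : ℝ) ^ (-(δ₁ * ((m : ℝ) + 1))) * 2 ^ (m + 1) ≤ Y.card →
      ∃ B : Finset (Option (Fin m)), (B.card : ℝ) ≤ ε₁ * ((m : ℝ) + 1) ∧ ∀ i ∉ B, ∀ b : Bool,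
        (Y.card : ℝ) / ((1 + ε₁) * 2) ≤ (Y.filter fun y => y i = b).card ∧
        ((Y.filter fun y => y i = b).card : ℝ) ≤ (1 + ε₁) * Y.card / 2)
    (hdens : (2 : ℝ) ^ (-(δ₁ * ((m : ℝ) + 1))) * 2 ^ (m + 1) ≤
      (2 : ℝ) ^ (-(δ * (m : ℝ))) * m.choose ((m + 1) / 2))
    (𝓤 : Finset (Finset (Fin (rvN k m)))) (𝓜 : Finset ((⊤ : SimpleGraph (Fin (rvN k m))).Subgraph))
    (τ : Bij k m) {I : Finset (Fin m)} (hI : I.card = (m + 1) / 2) :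
    (((swapsU k I).filter fun p => UBad k m 𝓤 𝓜 ε δ ((smallSwap p.1 p.2).trans τ)).card : ℝ) ≤
      2 * ε₁ * (swapsU k I).card := by
  rcases ((swapsU k I).filter fun p =>
      UBad k m 𝓤 𝓜 ε δ ((smallSwap p.1 p.2).trans τ)).eq_empty_or_nonempty with hS | ⟨p₀, hp₀⟩
  · rw [hS, card_empty, Nat.cast_zero]
    positivity
  have hbad₀ := (mem_filter.1 hp₀).2
  unfold UBad at hbad₀
  have hns : ¬ Small k m 𝓤 𝓜 δ ((smallSwap p₀.1 p₀.2).trans τ) := hbad₀.1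
  unfold Small at hns
  push Not at hns
  have hC : (0 : ℝ) < m.choose ((m + 1) / 2) := by exact_mod_cast Nat.choose_pos (by omega)
  have hY : (2 : ℝ) ^ (-(δ₁ * ((m : ℝ) + 1))) * 2 ^ (m + 1) ≤ (Ycut k 𝓤 τ).card := by
    refine hdens.trans ?_
    have hpU := hns.2
    rw [pU_smallSwap hk, lt_div_iff₀ hC] at hpU
    have h2 : (((Ycut k 𝓤 τ).filter fun y => y p₀.1 = false).card : ℝ) ≤ (Ycut k 𝓤 τ).card := by
      exact_mod_cast card_filter_le _ _
    linarith
  obtain ⟨B, hBcard, hB⟩ := hL10 _ hY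
  have hsub : ((swapsU k I).filter fun p => UBad k m 𝓤 𝓜 ε δ ((smallSwap p.1 p.2).trans τ)) ⊆
      B ×ˢ (univ : Finset (Equiv.Perm (Fin (k - 3)))) := by
    intro p hp
    have hbad := (mem_filter.1 hp).2
    unfold UBad at hbad
    rw [mem_product]
    refine ⟨?_, mem_univ _⟩
    by_contra hjB
    refine hbad.2 (ugood_of_unbiased hk hm hε₁ hε p.2 ?_ (hB p.1 hjB))
    have hns' := hbad.1
    unfold Small at hns'
    push Not at hns'
    exact lt_trans (by positivity) hns'.2
  have hm2 : ((m : ℝ) + 1) = 2 * (((m + 1) / 2 : ℕ) : ℝ) := by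
    obtain ⟨r, rfl⟩ := hm
    have e : (2 * r + 1 + 1) / 2 = r + 1 := by omega
    rw [e]
    push_cast
    ring
  calc (((swapsU k I).filter fun p => UBad k m 𝓤 𝓜 ε δ ((smallSwap p.1 p.2).trans τ)).card : ℝ)
      ≤ ((B ×ˢ (univ : Finset (Equiv.Perm (Fin (k - 3))))).card : ℝ) := by
        exact_mod_cast card_le_card hsub
    _ = B.card * ((univ : Finset (Equiv.Perm (Fin (k - 3)))).card : ℝ) := by
        rw [card_product, Nat.cast_mul]
    _ ≤ ε₁ * ((m : ℝ) + 1) * ((univ : Finset (Equiv.Perm (Fin (k - 3)))).card : ℝ) := by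
        gcongr
    _ = 2 * ε₁ * (swapsU k I).card := by
        rw [card_swapsU, card_freeIdx hm hI, Nat.cast_mul, hm2]
        ring

/-! ### Lemma 14: summation over encodings -/

/-- `p^ex_U(τ)` as an average of cut indicators over the index sets `I`, `|I| = (m+1)/2`.
[cite: Rothvoss2017, §3.2] -/
theorem pU_eq_sum (hk : 3 < k) (𝓤 : Finset (Finset (Fin (rvN k m)))) (τ : Bij k m) :
    pU k m 𝓤 τ = (∑ I ∈ (univ : Finset (Fin m)).powersetCard ((m + 1) / 2),
      (if (cut₀ I : Finset (TV k m)).map τ.toEmbedding ∈ 𝓤 then (1 : ℝ) else 0)) /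
        (cuts₀ k m).card := by
  unfold pU
  congr 1
  rw [cuts₀, filter_image, card_image_of_injective _ (cut₀_injective hk), natCast_card_filter]

/-- `pU τ · pM τ` is the average over `I` of the weights `wU I τ`. [cite: Rothvoss2017, §3.6] -/
theorem pU_mul_pM_eq (hk : 3 < k) (𝓤 : Finset (Finset (Fin (rvN k m))))
    (𝓜 : Finset ((⊤ : SimpleGraph (Fin (rvN k m))).Subgraph)) (τ : Bij k m) :
    pU k m 𝓤 τ * pM k m 𝓜 τ =
      (∑ I ∈ (univ : Finset (Fin m)).powersetCard ((m + 1) / 2), wU k m 𝓤 𝓜 I τ) /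
        (cuts₀ k m).card := by
  rw [pU_eq_sum hk, div_mul_eq_mul_div, sum_mul]
  rfl

/-- The weight `wU I` is invariant under the swaps of `swapsU I` (the cut `cut₀ I` is fixed by them,
`map_cut₀_smallSwap`, and `p^ex_M` is unchanged, `pM_smallSwap`). [cite: Rothvoss2017, Lem. 14] -/
theorem wU_smallSwap (𝓤 : Finset (Finset (Fin (rvN k m))))
    (𝓜 : Finset ((⊤ : SimpleGraph (Fin (rvN k m))).Subgraph)) {I : Finset (Fin m)}
    {p : Option (Fin m) × Equiv.Perm (Fin (k - 3))} (hp : p ∈ swapsU k I) (τ : Bij k m) :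
    wU k m 𝓤 𝓜 I ((smallSwap p.1 p.2).trans τ) = wU k m 𝓤 𝓜 I τ := by
  unfold wU
  rw [pM_smallSwap, Equiv.trans_toEmbedding, ← map_map,
    map_cut₀_smallSwap (mem_freeIdx.1 (mem_swapsU.1 hp))]

/-- **Summation of Lemma 14 over encodings**: a per-encoding bound "at most an `η`-fraction of the
swaps in `swapsU I` give a `U`-bad encoding" yields
`∑_τ U-BAD(τ) pU τ pM τ ≤ η ∑_τ pU τ pM τ` (average `pU` over the template cuts `cut₀ I`, and apply the
uniform-cover count to each weight `wU I`). [cite: Rothvoss2017, §3.6 & Lem. 14] -/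
theorem sum_ubad_le (hk : 3 < k) {ε δ η : ℝ} (𝓤 : Finset (Finset (Fin (rvN k m))))
    (𝓜 : Finset ((⊤ : SimpleGraph (Fin (rvN k m))).Subgraph))
    (hper : ∀ (τ : Bij k m) (I : Finset (Fin m)), I.card = (m + 1) / 2 →
      (((swapsU k I).filter fun p => UBad k m 𝓤 𝓜 ε δ ((smallSwap p.1 p.2).trans τ)).card : ℝ) ≤
        η * (swapsU k I).card) :
    ∑ τ, (if UBad k m 𝓤 𝓜 ε δ τ then pU k m 𝓤 τ * pM k m 𝓜 τ else 0) ≤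
      η * ∑ τ, pU k m 𝓤 τ * pM k m 𝓜 τ := by
  have hc : (0 : ℝ) < (cuts₀ k m).card := by exact_mod_cast cuts₀_nonempty.card_pos
  have hwI : ∀ I ∈ (univ : Finset (Fin m)).powersetCard ((m + 1) / 2),
      ∑ τ, (if UBad k m 𝓤 𝓜 ε δ τ then wU k m 𝓤 𝓜 I τ else 0) ≤ η * ∑ τ, wU k m 𝓤 𝓜 I τ := by
    intro I hIP
    have hI : I.card = (m + 1) / 2 := (mem_powersetCard.1 hIP).2
    refine sum_bad_le_of_cover (swapsU k I) (swapsU_nonempty I) (fun p => smallSwap p.1 p.2)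
      (wU k m 𝓤 𝓜 I) (fun τ => ?_) (fun p hp τ => wU_smallSwap 𝓤 𝓜 hp τ) _
      (fun τ => hper τ I hI)
    unfold wU
    exact mul_nonneg (by split_ifs <;> norm_num) (pM_mem τ).1
  calc ∑ τ, (if UBad k m 𝓤 𝓜 ε δ τ then pU k m 𝓤 τ * pM k m 𝓜 τ else 0)
      = ∑ τ, (∑ I ∈ (univ : Finset (Fin m)).powersetCard ((m + 1) / 2),
          if UBad k m 𝓤 𝓜 ε δ τ then wU k m 𝓤 𝓜 I τ else 0) / (cuts₀ k m).card := by
        refine sum_congr rfl fun τ _ => ?_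
        split_ifs with h
        · rw [pU_mul_pM_eq hk]
        · simp
    _ = (∑ I ∈ (univ : Finset (Fin m)).powersetCard ((m + 1) / 2),
          ∑ τ, if UBad k m 𝓤 𝓜 ε δ τ then wU k m 𝓤 𝓜 I τ else 0) / (cuts₀ k m).card := by
        rw [← sum_div, sum_comm]
    _ ≤ (∑ I ∈ (univ : Finset (Fin m)).powersetCard ((m + 1) / 2),
          η * ∑ τ, wU k m 𝓤 𝓜 I τ) / (cuts₀ k m).card := by
        gcongr with I hIP
        exact hwI I hIP
    _ = η * ∑ τ, pU k m 𝓤 τ * pM k m 𝓜 τ := by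
        rw [← mul_sum, sum_comm, mul_div_assoc, sum_div]
        simp only [pU_mul_pM_eq hk]

/-- **The `U`-bad part of Lemma 7 (Lemma 14 of Rothvoss 2017, summed form)**:
`∑_τ U-BAD(τ) · pU τ · pM τ ≤ 2ε₁ · ∑_τ pU τ · pM τ`, for `(1+ε₁)² ≤ 1+ε`, the entropy lemma for
`0/1`-vectors on `m+1` coordinates with parameters `(ε₁, δ₁)` (hypothesis `hL10`, an instance of
`few_biased_coordinates`), and `m` so large that `2^{-δ₁(m+1)} 2^{m+1} ≤ 2^{-δ m} binom(m, (m+1)/2)`.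
[cite: Rothvoss2017, Lem. 14] -/
theorem ubad_part (hk : 3 < k) (hm : Odd m) {ε ε₁ δ δ₁ : ℝ} (hε₁ : 0 ≤ ε₁)
    (hε : (1 + ε₁) ^ 2 ≤ 1 + ε)
    (hL10 : ∀ Y : Finset (Option (Fin m) → Bool),
      (2 : ℝ) ^ (-(δ₁ * ((m : ℝ) + 1))) * 2 ^ (m + 1) ≤ Y.card →
      ∃ B : Finset (Option (Fin m)), (B.card : ℝ) ≤ ε₁ * ((m : ℝ) + 1) ∧ ∀ i ∉ B, ∀ b : Bool,
        (Y.card : ℝ) / ((1 + ε₁) * 2) ≤ (Y.filter fun y => y i = b).card ∧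
        ((Y.filter fun y => y i = b).card : ℝ) ≤ (1 + ε₁) * Y.card / 2)
    (hdens : (2 : ℝ) ^ (-(δ₁ * ((m : ℝ) + 1))) * 2 ^ (m + 1) ≤
      (2 : ℝ) ^ (-(δ * (m : ℝ))) * m.choose ((m + 1) / 2))
    (𝓤 : Finset (Finset (Fin (rvN k m)))) (𝓜 : Finset ((⊤ : SimpleGraph (Fin (rvN k m))).Subgraph)) :
    ∑ τ, (if UBad k m 𝓤 𝓜 ε δ τ then pU k m 𝓤 τ * pM k m 𝓜 τ else 0) ≤
      2 * ε₁ * ∑ τ, pU k m 𝓤 τ * pM k m 𝓜 τ :=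
  sum_ubad_le hk 𝓤 𝓜 fun τ _ hI => card_ubad_le hk hm hε₁ hε hL10 hdens 𝓤 𝓜 τ hI

end Rothvoss

end Literature.Computability.Complexity
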